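import Summits.ABC.IUTFork.Joshi.ThetaEvaluationBridge
import HarnessLib

/-!
# Joshi's log-shells — the `p*`-NORMALISED bridge §9.1.1 ⟶ §9.6–9.7: over slot T-19's `BlochKatoDatum` all of slot T-21's local
# hypotheses AND the displayed formulas (9.7.2.2) hold together; Prop. 9.7.2.3 reduces to one Kummer-theory input — no side taken

Block-E record file (rung LADDER-ABC:A2.E; seat abc-iut-E-t19, slot T-19 fallback «merge-debt / DERIVABLE rows»; COMPLEMENT to
abc-iut-E-t21's `Joshi/ThetaEvaluationBridge.lean` p430023). Source: K. Joshi, *Construction of Arithmetic Teichmuller Spaces III*,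
arXiv:2401.13508 v4 («Preliminary version for comments», bib `Joshi2024ATS3`, UNREFEREED, rejected by the IUT author
[Mochizuki2024JoshiReport]); «p. N l. a–b» = PDF page of the render `HOME/lit/renders/Joshi-arxiv-2401.13508/`.

CONTEXT. E-t21's bridge builds `ATS3.LocalBKDatum.ofBlochKato D` from `D : BlochKatoDatum p E H1` with the Bloch–Kato exponential in
the normalisation (9.1.1.3)/(9.7.1.1) print (`log_BK = log_E`, = `log_p` on unit classes), DISCHARGES `H1eEqH1f`,
`OneUnitsKummerFontaine`, `PrincipalUnitsCrystalline`, Lemma 9.6.2.2 (`XiCrystalline`), and REFUTES for that datum the displayed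
VALUES of (9.7.2.2), `LogBKPrincipalUnits` / `LogBKXiFormula` («`log_BK(ξ) = log_p(1 + p*_w·q^{1/2ℓ})/p*_w`», p. 110 l. 55–75): the
two printed normalisations differ by the constant `p*_w`.

THIS FILE (the other reading, so that the referee sees BOTH are kernel-consistent up to that one constant): the same construction
with the exponential TWISTED BY `p*`, `e_BK(x) := dec⁻¹(p*·x, 0)` (`bkDatumNormalised`, `tateDatumNormalised`). RESULTS (kernel,
from E-t19's §9.1.1 FIELDS only): over the normalised datum
* `H1eEqH1f`, `OneUnitsKummerFontaine`, `PrincipalUnitsCrystalline` hold (as before) AND `LogBKPrincipalUnits` ((9.7.2.2) for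
  principal units) HOLDS (`bkDatumNormalised_logBKPrincipalUnits`), hence `XiCrystalline` (Lemma 9.6.2.2) and `LogBKXiFormula`
  ((9.7.2.2) at `ξ_w`) HOLD (`tateDatumNormalised_logBKXiFormula`) — all five local statements of slot T-21 at once;
* Prop. 9.7.2.3, first clause (`LogShellEqLogBKImage`: «`I = log_BK(H¹_e(G, ℤ_p(1)))`», p. 111 l. 17–26) is EQUIVALENT to
  `toE″(HZ ∩ H¹_e) = log_p(𝒪^×)` (`bkDatumNormalised_logShellEqLogBKImage_iff`), whose «⊇» is DERIVED
  (`logUnits_subset_toE_image_integral`) and whose «⊆» is the classical Kummer-theory property of the INTENDED model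
  `IntegralClassesAreUnitClasses` (`H¹(G_E, ℤ_p(1)) ≅ (E^×)^∧`: an integral class with valuation component `0` is the class of a
  unit) — a named predicate on the datum, not asserted; under it the whole `Prop9723` HOLDS (`tateDatumNormalised_prop9723`).
So the `p*_w` tension E-t21 certified is EXACTLY a choice of normalisation constant: with (9.1.1.3) read literally (9.7.2.2)'s
values fail; with `e_BK` rescaled by `p*` everything in §9.6–9.7.2 holds and Prop. 9.7.2.3 needs only the Kummer input. Which
reading print intends is for E-ref; no judgement here. Typed ≠ proved ≠ endorsed; nothing asserts abc, [IUTchIII] Cor. 3.12, or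
any claim of [J-III]. [claim: Joshi2024ATS3, status: disputed]
-/

set_option autoImplicit false

noncomputable section

open Set Metric
open scoped Pointwise

namespace Summit.ABC.IUTFork.Joshi

open Literature.IUT.LogVolume Literature.AnabelianGeometry.AbsoluteAnabelian

namespace BlochKatoDatum

variable {p : ℕ} [Fact p.Prime] {E : Type} [NontriviallyNormedField E] [NormedAlgebra ℚ_[p] E]
variable {H1 : Type} [AddCommGroup H1] [Module ℚ_[p] H1] (D : BlochKatoDatum p E H1)

section Exp

/-- `dec⁻¹(a, 0) ∈ H¹_e` (= `H¹_f` = the classes with valuation component `0`). [claim: Joshi2024ATS3, status: disputed] -/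
theorem dec_symm_mem_He (a : E) : D.dec.symm (a, 0) ∈ (D.He : Set H1) := by
  rw [SetLike.mem_coe, D.He_eq_Hf, D.mem_Hf_iff, LinearEquiv.apply_symm_apply]

/-- For a class in `H¹_e`, `dec` has valuation component `0`. [claim: Joshi2024ATS3, status: disputed] -/
theorem dec_snd_eq_zero_of_mem_He {x : H1} (hx : x ∈ (D.He : Set H1)) : (D.dec x).2 = 0 := by
  rw [SetLike.mem_coe, D.He_eq_Hf, D.mem_Hf_iff] at hx; exact hx

variable {c : E} (hc : c ≠ 0)
include hc

/-- **The Bloch–Kato exponential `e_BK : E ≃ H¹_e(G_E, ℚ_p(1))`** ((9.7.1.1), p. 110 l. 8–20) built from the (9.1.1.3) identification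
with a normalising constant `c ≠ 0` (`c = p*` below; `c = 1` is E-t21's `ATS3.eBKOfDec`): `x ↦ dec⁻¹(c·x, 0)`, inverse
`ξ ↦ c⁻¹·(dec ξ).1`. A bijection, PROVED. [claim: Joshi2024ATS3, status: disputed] -/
def expBK : E ≃ (D.He : Set H1) where
  toFun x := ⟨D.dec.symm (c * x, 0), D.dec_symm_mem_He _⟩
  invFun ξ := c⁻¹ * (D.dec (ξ : H1)).1
  left_inv x := by simp [inv_mul_cancel_left₀ hc]
  right_inv ξ := by
    apply Subtype.ext
    have h2 := D.dec_snd_eq_zero_of_mem_He ξ.2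
    simp only [mul_inv_cancel_left₀ hc]
    have : ((D.dec (ξ : H1)).1, (0 : ℚ_[p])) = D.dec (ξ : H1) := by rw [← h2]
    rw [this, LinearEquiv.symm_apply_apply]

/-- The inverse `log_BK` of `expBK`: `ξ ↦ c⁻¹·(dec ξ).1`. [claim: Joshi2024ATS3, status: disputed] -/
theorem expBK_symm_apply (ξ : (D.He : Set H1)) : (D.expBK hc).symm ξ = c⁻¹ * (D.dec (ξ : H1)).1 := rfl

end Exp

/-- The classical Kummer-theory property of the INTENDED model of the signature (`H¹(G_E, ℤ_p(1)) ≅ (E^×)^∧`, so a class that is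
both integral and in `H¹_e = H¹_f` — valuation component `0` — is the class of a unit of `𝒪_E`): every `x ∈ HZ ∩ H¹_e` is `κ(u)` with
`‖u‖ = 1`. A named PROPERTY of the abstract datum (the residual input of Prop. 9.7.2.3 below); not asserted. [folklore] -/
def IntegralClassesAreUnitClasses : Prop :=
  ∀ x : H1, x ∈ D.integral D.He → ∃ u : Eˣ, ‖(u : E)‖ = 1 ∧ D.kummer u = x

/-- «⊇» of Prop. 9.7.2.3 at the level of `toE`: every element of `log_p(𝒪^×)` is `toE` of an integral `H¹_e`-class (the class of
that unit). DERIVED. [claim: Joshi2024ATS3, status: disputed] -/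
theorem logUnits_subset_toE_image_integral : logUnits E ⊆ D.toE '' (D.integral D.He : Set H1) := by
  rintro _ ⟨u, hu, rfl⟩
  rw [mem_setOf_eq] at hu
  have h0 : u ≠ 0 := norm_ne_zero_iff.1 (by rw [hu]; exact one_ne_zero)
  refine ⟨D.kummer (Units.mk0 u h0), ?_, ?_⟩
  · rw [SetLike.mem_coe, D.mem_integral_iff]
    exact ⟨D.kummer_mem_HZ _, (D.kummer_mem_He_iff_norm _).2 (by simpa using hu)⟩
  · rw [D.toE_apply, D.dec_kummer, D.logE_of_norm_eq_one _ (by simpa using hu)]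
    simp

/-- Under `IntegralClassesAreUnitClasses`, `toE″(HZ ∩ H¹_e) = log_p(𝒪^×)` exactly. DERIVED. [claim: Joshi2024ATS3, status: disputed] -/
theorem toE_image_integral_eq (h : D.IntegralClassesAreUnitClasses) : D.toE '' (D.integral D.He : Set H1) = logUnits E := by
  refine Subset.antisymm ?_ D.logUnits_subset_toE_image_integral
  rintro _ ⟨x, hx, rfl⟩
  obtain ⟨u, hu, rfl⟩ := h x hx
  rw [D.toE_apply, D.dec_kummer, D.logE_of_norm_eq_one _ hu]
  exact unitLog_mem_logUnits hu

variable [IsUltrametricDist E] [CompleteSpace E]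

/-- **THE `p*`-NORMALISED BRIDGE**: slot T-21's local Bloch–Kato datum built from the §9.1.1 signature exactly as E-t21's
`ATS3.LocalBKDatum.ofBlochKato` (logarithm `log_p`, Joshi's `p*`, `toQ` the inclusion of `HZ`, `H¹_e`, `H¹_f`, Kummer map
`ATS3.kummerZ`), EXCEPT that `e_BK` is twisted by `p*`: `e_BK(x) = dec⁻¹(p*·x, 0)`, i.e. `log_BK = p*⁻¹·log_E` — the normalisation
under which (9.7.2.2) prints `log_BK(ξ) = log_p(ξ)/p*`. [claim: Joshi2024ATS3, status: disputed] -/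
def bkDatumNormalised : ATS3.LocalBKDatum E D.HZ H1 where
  toPadicLogOnUnits := PadicLogOnUnits.ofUnitLog p E
  p := p
  prime_p := Fact.out
  pstar_eq_cast := by rw [PadicLogOnUnits.ofUnitLog_pstar, ATS3.pStar_eq_pow]
  toQ := Subtype.val
  H1e := D.He
  H1f := D.Hf
  kummer := ATS3.kummerZ D
  eBK := D.expBK (PadicLogOnUnits.ofUnitLog p E).pstar_ne_zero

/-- Projection: `H1e` of the normalised bridge is `H¹_e`. [folklore] -/
@[simp] theorem bkDatumNormalised_H1e : D.bkDatumNormalised.H1e = (D.He : Set H1) := rfl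

/-- Projection: `H1f` of the normalised bridge is `H¹_f`. [folklore] -/
@[simp] theorem bkDatumNormalised_H1f : D.bkDatumNormalised.H1f = (D.Hf : Set H1) := rfl

/-- Projection: `toQ` of the normalised bridge is the inclusion. [folklore] -/
@[simp] theorem bkDatumNormalised_toQ (c : D.HZ) : D.bkDatumNormalised.toQ c = (c : H1) := rfl

/-- Projection: `kummer` of the normalised bridge is `ATS3.kummerZ D`. [folklore] -/
@[simp] theorem bkDatumNormalised_kummer (x : E) : D.bkDatumNormalised.kummer x = ATS3.kummerZ D x := rfl

/-- Projection: `pstar` of the normalised bridge is the `p*` of `ofUnitLog`. [folklore] -/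
@[simp] theorem bkDatumNormalised_pstar : D.bkDatumNormalised.pstar = (PadicLogOnUnits.ofUnitLog p E).pstar := rfl

/-- Projection: the underlying `PadicLogOnUnits` of the normalised bridge is `ofUnitLog p E`. [folklore] -/
theorem bkDatumNormalised_toPadicLogOnUnits : D.bkDatumNormalised.toPadicLogOnUnits = PadicLogOnUnits.ofUnitLog p E := rfl

/-- Both bridges have the same underlying data except `e_BK`: same `toPadicLogOnUnits`. [folklore] -/
theorem bkDatumNormalised_toPadicLogOnUnits_eq_ofBlochKato :
    D.bkDatumNormalised.toPadicLogOnUnits = (ATS3.LocalBKDatum.ofBlochKato D).toPadicLogOnUnits := rfl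

/-- `log_BK` of the normalised bridge: `ξ ↦ p*⁻¹ · (dec ξ).1`. [claim: Joshi2024ATS3, status: disputed] -/
theorem bkDatumNormalised_logBK (ξ : (D.He : Set H1)) :
    D.bkDatumNormalised.logBK ξ = (PadicLogOnUnits.ofUnitLog p E).pstar⁻¹ * (D.dec (ξ : H1)).1 := rfl

/-- … = `p*⁻¹ ·` (E-t21's untwisted `log_BK`). [claim: Joshi2024ATS3, status: disputed] -/
theorem bkDatumNormalised_logBK_eq_mul_ofBlochKato (ξ : (D.He : Set H1)) :
    D.bkDatumNormalised.logBK ξ = (PadicLogOnUnits.ofUnitLog p E).pstar⁻¹ * (ATS3.LocalBKDatum.ofBlochKato D).logBK ξ := by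
  rw [bkDatumNormalised_logBK, ATS3.logBK_ofBlochKato_apply]

/-- Slot T-21's `H1eEqH1f` ((9.1.1.4)) HOLDS for the normalised bridge. DERIVED. [claim: Joshi2024ATS3, status: disputed] -/
theorem bkDatumNormalised_h1eEqH1f : D.bkDatumNormalised.H1eEqH1f := by
  unfold ATS3.LocalBKDatum.H1eEqH1f
  rw [bkDatumNormalised_H1e, bkDatumNormalised_H1f, D.He_eq_Hf]

/-- Slot T-21's `OneUnitsKummerFontaine` (Perrin-Riou step of Lemma 9.6.2.2) HOLDS for the normalised bridge (same data as
E-t21's bridge away from `e_BK`). DERIVED. [claim: Joshi2024ATS3, status: disputed] -/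
theorem bkDatumNormalised_oneUnitsKummerFontaine : D.bkDatumNormalised.OneUnitsKummerFontaine :=
  ATS3.oneUnitsKummerFontaine_ofBlochKato D

/-- Slot T-21's `PrincipalUnitsCrystalline` (p. 111 l. 1–12) HOLDS for the normalised bridge. DERIVED.
[claim: Joshi2024ATS3, status: disputed] -/
theorem bkDatumNormalised_principalUnitsCrystalline : D.bkDatumNormalised.PrincipalUnitsCrystalline :=
  ATS3.principalUnitsCrystalline_ofBlochKato D

/-- `log_BK` of the normalised bridge on the class of a unit `u`: `p*⁻¹ · log_p(u)`. [claim: Joshi2024ATS3, status: disputed] -/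
theorem bkDatumNormalised_logBK_kummer {u : E} (h1 : ‖u‖ = 1)
    (he : D.bkDatumNormalised.toQ (D.bkDatumNormalised.kummer u) ∈ D.bkDatumNormalised.H1e) :
    D.bkDatumNormalised.logBK ⟨_, he⟩ = (PadicLogOnUnits.ofUnitLog p E).pstar⁻¹ * unitLog u := by
  rw [bkDatumNormalised_logBK_eq_mul_ofBlochKato]
  exact congrArg _ (ATS3.logBK_ofBlochKato_kummer D h1 he)

/-- **Slot T-21's `LogBKPrincipalUnits` ((9.7.2.2) «`log_BK(ξ) = log_p(ξ)/p*`» for `ξ ≡ 1 mod p*`, p. 110 l. 55–75) HOLDS for the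
normalised bridge** (it FAILS for the untwisted one: `ATS3.not_logBKPrincipalUnits_ofBlochKato`). DERIVED.
[claim: Joshi2024ATS3, status: disputed] -/
theorem bkDatumNormalised_logBKPrincipalUnits : D.bkDatumNormalised.LogBKPrincipalUnits := by
  intro u hu he
  exact D.bkDatumNormalised_logBK_kummer (ATS3.norm_eq_one_of_mem_closedBall_pstar hu) he

/-- **All four local hypotheses of slot T-21 hold SIMULTANEOUSLY for the normalised bridge.** [claim: Joshi2024ATS3, status: disputed] -/
theorem bkDatumNormalised_hyps :
    D.bkDatumNormalised.H1eEqH1f ∧ D.bkDatumNormalised.OneUnitsKummerFontaine ∧ D.bkDatumNormalised.PrincipalUnitsCrystalline ∧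
      D.bkDatumNormalised.LogBKPrincipalUnits :=
  ⟨D.bkDatumNormalised_h1eEqH1f, D.bkDatumNormalised_oneUnitsKummerFontaine, D.bkDatumNormalised_principalUnitsCrystalline,
    D.bkDatumNormalised_logBKPrincipalUnits⟩

/-! ## Prop. 9.7.2.3, first clause, for the normalised bridge: reduced to «integral `H¹_e`-classes are unit classes» -/

/-- The image of `log_BK` on the integral `H¹_e`-classes of the normalised bridge is `p*⁻¹ · toE″(HZ ∩ H¹_e)`.
[claim: Joshi2024ATS3, status: disputed] -/
theorem bkDatumNormalised_logBKImage :
    D.bkDatumNormalised.logBKImage = (PadicLogOnUnits.ofUnitLog p E).pstar⁻¹ • (D.toE '' (D.integral D.He : Set H1)) := by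
  ext x
  constructor
  · rintro ⟨c, hc, rfl⟩
    rw [bkDatumNormalised_toQ, bkDatumNormalised_H1e] at hc
    refine Set.mem_smul_set.2 ⟨D.toE (c : H1), ⟨(c : H1), ?_, rfl⟩, ?_⟩
    · rw [SetLike.mem_coe, D.mem_integral_iff]; exact ⟨c.2, hc⟩
    · rw [bkDatumNormalised_logBK, D.toE_apply, smul_eq_mul]; rfl
  · intro hx
    obtain ⟨_, ⟨y, hy, rfl⟩, rfl⟩ := Set.mem_smul_set.1 hx
    rw [SetLike.mem_coe, D.mem_integral_iff] at hy
    refine ⟨⟨y, hy.1⟩, ?_, ?_⟩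
    · rw [bkDatumNormalised_toQ, bkDatumNormalised_H1e]; exact hy.2
    · rw [bkDatumNormalised_logBK, D.toE_apply, smul_eq_mul]; rfl

/-- **Prop. 9.7.2.3 (first clause) for the normalised bridge** («Mochizuki's log-shell can be identified with the image, under the
Bloch–Kato logarithm, of `H¹_e(G, ℤ_p(1))`», p. 111 l. 17–26): EQUIVALENT to `toE″(HZ ∩ H¹_e) = log_p(𝒪^×)`. DERIVED.
[claim: Joshi2024ATS3, status: disputed] -/
theorem bkDatumNormalised_logShellEqLogBKImage_iff :
    D.bkDatumNormalised.LogShellEqLogBKImage ↔ D.toE '' (D.integral D.He : Set H1) = logUnits E := by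
  unfold ATS3.LocalBKDatum.LogShellEqLogBKImage
  rw [bkDatumNormalised_toPadicLogOnUnits, bkDatumNormalised_logBKImage, logShell_ofUnitLog, PadicLogOnUnits.ofUnitLog_pstar]
  constructor
  · intro h
    have h' := congrArg (fun s : Set E => ((p ^ (if p = 2 then 2 else 1) : ℕ) : E) • s) h
    simp only [smul_inv_smul₀ (pstarNat_cast_ne_zero p E)] at h'
    exact h'.symm
  · intro h; rw [h]

/-- … hence HOLDS given the Kummer-theory input. [claim: Joshi2024ATS3, status: disputed] -/
theorem bkDatumNormalised_logShellEqLogBKImage (h : D.IntegralClassesAreUnitClasses) : D.bkDatumNormalised.LogShellEqLogBKImage :=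
  D.bkDatumNormalised_logShellEqLogBKImage_iff.2 (D.toE_image_integral_eq h)

/-- **Prop. 9.2.1.5 (3), integral half, in the (9.7.2.2) normalisation**: `I = mochizukiLogShell p E = p*⁻¹ · toE″(HZ ∩ H¹_f)` under
`IntegralClassesAreUnitClasses`. (Slot T-19's `LogShellIsBlochKato` states the UNtwisted `I = toE″(HZ ∩ H¹_f)`; the two differ
by the constant `p*` — referee flag F1, recorded, no judgement.) DERIVED. [claim: Joshi2024ATS3, status: disputed] -/
theorem mochizukiLogShell_eq_smul_toE_image (h : D.IntegralClassesAreUnitClasses) :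
    mochizukiLogShell p E = ((p ^ (if p = 2 then 2 else 1) : ℕ) : E)⁻¹ • (D.toE '' (D.integral D.Hf : Set H1)) := by
  rw [← D.He_eq_Hf, D.toE_image_integral_eq h, mochizukiLogShell_eq_logShell, logShell_ofUnitLog]

/-! ## The normalised Tate datum at `w ∈ V^{odd,ss}_p`: Lemma 9.6.2.2, (9.7.2.2) at `ξ_w`, and Prop. 9.7.2.3 -/

section Tate

variable (hp2 : p ≠ 2) (l : ℕ) (hl : 1 ≤ l) (q2l : E) (hq0 : q2l ≠ 0) (hq1 : ‖q2l‖ < 1)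

/-- The Tate datum of 9.6.2 (`ℓ`, the root `q^{1/2ℓ} ∈ 𝔪 ∖ 0`, `p` odd) over the NORMALISED local datum (cf. E-t21's
`ATS3.TateLocalDatum.ofBlochKato` over the untwisted one). [claim: Joshi2024ATS3, status: disputed] -/
def tateDatumNormalised : ATS3.TateLocalDatum E D.HZ H1 where
  toLocalBKDatum := D.bkDatumNormalised
  p_ne_two := hp2
  l := l
  one_le_l := hl
  q2l := q2l
  q2l_ne_zero := hq0
  norm_q2l_lt_one := hq1

/-- **Lemma 9.6.2.2 (`XiCrystalline`: «`ξ_w ∈ H¹_e(G_{L′_w};K_w, ℤ_p(1))`», p. 109 l. 62 – p. 110 l. 6) HOLDS for the normalised Tate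
datum.** DERIVED. [claim: Joshi2024ATS3, status: disputed] -/
theorem tateDatumNormalised_xiCrystalline : (D.tateDatumNormalised hp2 l hl q2l hq0 hq1).XiCrystalline :=
  (D.tateDatumNormalised hp2 l hl q2l hq0 hq1).xiCrystalline_of_principalUnitsCrystalline
    D.bkDatumNormalised_principalUnitsCrystalline

/-- **(9.7.2.2) at `ξ_w` (`LogBKXiFormula`: «`log_BK(ξ_w) = log_p(1 + p*_w·q^{1/2ℓ})/p*_w`», p. 110 l. 55–75) HOLDS for the normalised
Tate datum** (it FAILS for the untwisted one: `ATS3.not_logBKXiFormula_ofBlochKato`). DERIVED via E-t21's `logBKXiFormula_of`.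
[claim: Joshi2024ATS3, status: disputed] -/
theorem tateDatumNormalised_logBKXiFormula : (D.tateDatumNormalised hp2 l hl q2l hq0 hq1).LogBKXiFormula :=
  (D.tateDatumNormalised hp2 l hl q2l hq0 hq1).logBKXiFormula_of D.bkDatumNormalised_principalUnitsCrystalline
    D.bkDatumNormalised_logBKPrincipalUnits

/-- **Prop. 9.7.2.3 (both clauses, slot T-21's `Prop9723`) HOLDS for the normalised Tate datum, given the single Kummer-theory input
`IntegralClassesAreUnitClasses`.** DERIVED via E-t21's `prop9723_of`. [claim: Joshi2024ATS3, status: disputed] -/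
theorem tateDatumNormalised_prop9723 (h : D.IntegralClassesAreUnitClasses) : (D.tateDatumNormalised hp2 l hl q2l hq0 hq1).Prop9723 :=
  (D.tateDatumNormalised hp2 l hl q2l hq0 hq1).prop9723_of (D.bkDatumNormalised_logShellEqLogBKImage h)
    (D.tateDatumNormalised_logBKXiFormula hp2 l hl q2l hq0 hq1)

end Tate

end BlochKatoDatum

end Summit.ABC.IUTFork.Joshi

end
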